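import Summits.AtomisticToContinuum.HydrodynamicLimit.Theorems.RelayRaceLocalityRestartPrincipleRenyiTransport
import Summits.AtomisticToContinuum.HydrodynamicLimit.Theorems.RelayRaceLocalityRestartPrincipleCgfFromLD
import Summits.AtomisticToContinuum.HydrodynamicLimit.Theorems.RelayRaceLocalityRestartPrincipleRenyiAlgebra
import Summits.AtomisticToContinuum.HydrodynamicLimit.Theorems.RelayRaceLocalityRestartPrincipleIsentropicCentring
import Literature.MathematicalPhysics.KineticTheory.HardSphereBBGKYLiouvilleFlow
import HarnessLib

/-!
# Crux `RestartPrinciple` (stmt-AtomisticToContinuum-12503), line `isentropic-regibbsification` — the reduction (R2)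

Lead c4. `renyiLocalEquilibriumLDA_of`: the skeleton's Rényi short-time local equilibrium for the FRESH LDA gas
follows from the three registered stubs `stub_noAnomalousDissipation` (THE BET), `stub_kineticEnergyExpMoment`
(landed p117016), `stub_staticFlatness` — taken VERBATIM as hypotheses, so this file lands before they do — and the
shared statics `JaynesSqueeze.HardSphereLDA` (13459) / `LocalGibbsConcentrationDilute` (13460). Ingredients:
`hellingerIntegral_lawAt_localGibbsLaw_eq_lintegral` (RenyiTransport), `lintegral_exp_mul_add_le_of_largeDeviation`
(CgfFromLD), `renyiDiv_le_of_hellingerIntegral_le`, `ofReal_mul_rpow_div_eq`, `log_canonicalDensity_eq`,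
`exists_neg_log_localGibbsProfile_le` (RenyiAlgebra), `tendsto_isentropicCentring`, `exists_eos_band`
(IsentropicCentring), `HardSphereFlow.configEnergy_flow`.
-/

noncomputable section

open Literature.MathematicalPhysics.KineticTheory Literature.Analysis.FluidPDE
open Literature.Analysis.FunctionSpaces MeasureTheory Filter Set Topology
open scoped ENNReal

namespace Summit.AtomisticToContinuum.HydrodynamicLimit.Theorems.RestartPrinciple.IsentropicRegibbsification

section Reduction

open Literature.Probability.Divergences InformationTheory

/-- Continuity of the LDA activity of a continuous positive density inside a band on which `f_ex` and
`f_ex'` are continuous. [folklore] -/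
theorem continuous_lda_of_band {ηE σ : ℝ} (hfc : ContinuousOn hsExcessFreeEnergy (Ioo 0 ηE))
    (hdc : ContinuousOn (deriv hsExcessFreeEnergy) (Ioo 0 ηE)) (hσ : 0 < σ) {ρ₁ : T3 → ℝ}
    (hρc : Continuous ρ₁) (hρ0 : ∀ x, 0 < ρ₁ x) (hband : ∀ x, ρ₁ x * σ ^ 3 < ηE) :
    Continuous fun x => ρ₁ x * Real.exp (hsExcessFreeEnergy (ρ₁ x * σ ^ 3) +
      ρ₁ x * σ ^ 3 * deriv hsExcessFreeEnergy (ρ₁ x * σ ^ 3)) := by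
  have hpc : Continuous fun x => ρ₁ x * σ ^ 3 := hρc.mul continuous_const
  have hpm : ∀ x, ρ₁ x * σ ^ 3 ∈ Ioo 0 ηE := fun x => ⟨mul_pos (hρ0 x) (pow_pos hσ 3), hband x⟩
  exact hρc.mul (Real.continuous_exp.comp
    ((hfc.comp_continuous hpc hpm).add (hpc.mul (hdc.comp_continuous hpc hpm))))

/-- The kinetic energy is a measurable function of the configuration. [folklore] -/
theorem measurable_configEnergy_T3 {n : ℕ} : Measurable (configEnergy : Config n (Fin 3) T3 → ℝ) := by
  unfold configEnergy
  refine measurable_const.mul (Finset.measurable_sum _ fun i _ => ?_)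
  exact ((measurable_pi_apply i).snd.norm).pow_const 2

/-- **THE REDUCTION (R2).** The Rényi short-time local equilibrium for the fresh LDA gas (verbatim conclusion of
the skeleton's `stub_renyiLocalEquilibriumLDA`) from (a) the one-sided bet `stub_noAnomalousDissipation`, (b) the
Gaussian kinetic-energy moment `stub_kineticEnergyExpMoment` (+ energy conservation: moments of the DROP), (c) the
static flatness `stub_staticFlatness`, (d) `HardSphereLDA` (centring) and `LocalGibbsConcentrationDilute` (for (c)):
Liouville identity `∫(d(Φ_r)_*G_s/dG_t)^{1+γ}dG_t = e^{γ(N+1)c_N} E_{G_s}e^{γ(X_N+Y_N)}`, exponential moment of the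
sum from the one-sided LD bound, `c_N → 0`, and `D_{1+γ} = γ⁻¹ log ∫(dC/dG)^{1+γ}dG`.
[cite: Yau1991, §1; OllaVaradhanYau1993, §3] -/
theorem renyiLocalEquilibriumLDA_of
    (hNAD : ∃ η₀ : ℝ, 0 < η₀ ∧ ∃ σ₀ : ℝ, 0 < σ₀ ∧ ∀ σ : ℝ, 0 < σ → σ < σ₀ → ∀ M : ℝ, 0 < M →
      ∃ τ₁ : ℝ, 0 < τ₁ ∧ ∀ (T : ℝ) (ρ θ : ℝ → T3 → ℝ) (u : ℝ → T3 → V3),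
      IsHardSphereEulerSolution σ T ρ u θ → (∀ s' ∈ Set.Ico 0 T, ∫ x, ρ s' x = 1) →
      ∀ Φ : (N : ℕ) → HardSphereFlow (Torus.geometry (Fin 3)) (hsDiameter σ N) (N + 1),
      ∀ s ∈ Set.Ico 0 T, ∀ t ∈ Set.Ico s (min T (s + τ₁)),
      (∀ s' ∈ Set.Icc s t, ∀ x, ρ s' x * σ ^ 3 < η₀ ∧ ρ s' x ≤ M ∧ θ s' x ≤ M ∧ M⁻¹ ≤ θ s' x ∧
      ‖u s' x‖ ≤ M ∧ ∀ i j k : Fin 3, |Torus.partialDeriv i (ρ s') x| ≤ M ∧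
      ‖Torus.partialDeriv i (u s') x‖ ≤ M ∧ |Torus.partialDeriv i (θ s') x| ≤ M ∧
      |Torus.partialDeriv i (Torus.partialDeriv j (ρ s')) x| ≤ M ∧
      ‖Torus.partialDeriv i (Torus.partialDeriv j (u s')) x‖ ≤ M ∧
      |Torus.partialDeriv i (Torus.partialDeriv j (θ s')) x| ≤ M ∧
      |Torus.partialDeriv i (Torus.partialDeriv j (Torus.partialDeriv k (ρ s'))) x| ≤ M ∧
      ‖Torus.partialDeriv i (Torus.partialDeriv j (Torus.partialDeriv k (u s'))) x‖ ≤ M ∧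
      |Torus.partialDeriv i (Torus.partialDeriv j (Torus.partialDeriv k (θ s'))) x| ≤ M) →
      ∀ δ : ℝ, 0 < δ → ∃ C : ℝ, 0 < C ∧ ∀ N : ℕ,
      localGibbsLaw σ (fun x => ρ s x * Real.exp (hsExcessFreeEnergy (ρ s x * σ ^ 3) +
      ρ s x * σ ^ 3 * deriv hsExcessFreeEnergy (ρ s x * σ ^ 3))) (u s) (θ s) N (Φ N)
      {z | ((N : ℝ) + 1)⁻¹ * ∑ i, Real.log (localGibbsProfile
      (fun x => ρ t x * Real.exp (hsExcessFreeEnergy (ρ t x * σ ^ 3) +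
      ρ t x * σ ^ 3 * deriv hsExcessFreeEnergy (ρ t x * σ ^ 3))) (u t) (θ t)
      ((Φ N).flow (t - s) z i)) <
      (∫ x, ρ t x * (Real.log (ρ t x * Real.exp (hsExcessFreeEnergy (ρ t x * σ ^ 3) +
      ρ t x * σ ^ 3 * deriv hsExcessFreeEnergy (ρ t x * σ ^ 3))) -
      3 / 2 * Real.log (2 * Real.pi * θ t x) - 3 / 2)) - δ} ≤
      ENNReal.ofReal (C * Real.exp (-(C⁻¹ * (N + 1)))))
    (hKE : ∀ σ : ℝ, 0 < σ → σ ≤ 1 / 2 →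
      ∀ (a θ₁ : T3 → ℝ) (u₁ : T3 → V3), Continuous a → Continuous θ₁ → Continuous u₁ →
      (∀ x, 0 < a x) → (∀ x, 0 < θ₁ x) →
      ∃ K : ℝ, ∃ γ₂ : ℝ, 0 < γ₂ ∧ ∀ γ : ℝ, 0 < γ → γ ≤ γ₂ →
      ∀ (N : ℕ) (Φ : HardSphereFlow (Torus.geometry (Fin 3)) (hsDiameter σ N) (N + 1)),
      ∫⁻ z, ENNReal.ofReal (Real.exp (γ * configEnergy z)) ∂(localGibbsLaw σ a u₁ θ₁ N Φ) ≤
      ENNReal.ofReal (Real.exp (γ * K * ((N : ℝ) + 1))))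
    (hFlat : Theses.JaynesSqueeze.LocalGibbsConcentrationDilute →
      ∃ η₁ : ℝ, 0 < η₁ ∧ ∀ σ : ℝ, 0 < σ → σ ≤ 1 / 2 →
      ∀ (ρ₁ θ₁ : T3 → ℝ) (u₁ : T3 → V3), Continuous ρ₁ → Continuous θ₁ → Continuous u₁ →
      (∀ x, 0 < ρ₁ x) → (∀ x, 0 < θ₁ x) → ∫ x, ρ₁ x = 1 → (∀ x, ρ₁ x * σ ^ 3 ≤ η₁) →
      ∀ Φ : (N : ℕ) → HardSphereFlow (Torus.geometry (Fin 3)) (hsDiameter σ N) (N + 1),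
      ∀ ε : ℝ, 0 < ε → ∃ γ₁ : ℝ, 0 < γ₁ ∧ ∀ γ : ℝ, 0 < γ → γ ≤ γ₁ → ∀ᶠ N : ℕ in atTop,
      ∫⁻ z, ENNReal.ofReal (Real.exp (γ *
      ((∑ i, Real.log (localGibbsProfile
      (fun x => ρ₁ x * Real.exp (hsExcessFreeEnergy (ρ₁ x * σ ^ 3) +
      ρ₁ x * σ ^ 3 * deriv hsExcessFreeEnergy (ρ₁ x * σ ^ 3))) u₁ θ₁ (z i))) -
      ((N : ℝ) + 1) * ∫ x, ρ₁ x *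
      (Real.log (ρ₁ x * Real.exp (hsExcessFreeEnergy (ρ₁ x * σ ^ 3) +
      ρ₁ x * σ ^ 3 * deriv hsExcessFreeEnergy (ρ₁ x * σ ^ 3))) -
      3 / 2 * Real.log (2 * Real.pi * θ₁ x) - 3 / 2))))
      ∂(localGibbsLaw σ (fun x => ρ₁ x * Real.exp (hsExcessFreeEnergy (ρ₁ x * σ ^ 3) +
      ρ₁ x * σ ^ 3 * deriv hsExcessFreeEnergy (ρ₁ x * σ ^ 3))) u₁ θ₁ N (Φ N)) ≤
      ENNReal.ofReal (Real.exp (γ * ε * ((N : ℝ) + 1))))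
    (hLDA : Theses.JaynesSqueeze.HardSphereLDA)
    (hLGC : Theses.JaynesSqueeze.LocalGibbsConcentrationDilute) :
    ∃ η₀ : ℝ, 0 < η₀ ∧ ∃ σ₀ : ℝ, 0 < σ₀ ∧ ∀ σ : ℝ, 0 < σ → σ < σ₀ → ∀ M : ℝ, 0 < M →
    ∃ τ₁ : ℝ, 0 < τ₁ ∧ ∀ (T : ℝ) (ρ θ : ℝ → T3 → ℝ) (u : ℝ → T3 → V3),
    IsHardSphereEulerSolution σ T ρ u θ → (∀ s' ∈ Set.Ico 0 T, ∫ x, ρ s' x = 1) →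
    ∀ Φ : (N : ℕ) → HardSphereFlow (Torus.geometry (Fin 3)) (hsDiameter σ N) (N + 1),
    ∀ s ∈ Set.Ico 0 T, ∀ t ∈ Set.Ico s (min T (s + τ₁)),
    (∀ s' ∈ Set.Icc s t, ∀ x, ρ s' x * σ ^ 3 < η₀ ∧ ρ s' x ≤ M ∧ θ s' x ≤ M ∧ M⁻¹ ≤ θ s' x ∧
    ‖u s' x‖ ≤ M ∧ ∀ i j k : Fin 3, |Torus.partialDeriv i (ρ s') x| ≤ M ∧
    ‖Torus.partialDeriv i (u s') x‖ ≤ M ∧ |Torus.partialDeriv i (θ s') x| ≤ M ∧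
    |Torus.partialDeriv i (Torus.partialDeriv j (ρ s')) x| ≤ M ∧
    ‖Torus.partialDeriv i (Torus.partialDeriv j (u s')) x‖ ≤ M ∧
    |Torus.partialDeriv i (Torus.partialDeriv j (θ s')) x| ≤ M ∧
    |Torus.partialDeriv i (Torus.partialDeriv j (Torus.partialDeriv k (ρ s'))) x| ≤ M ∧
    ‖Torus.partialDeriv i (Torus.partialDeriv j (Torus.partialDeriv k (u s'))) x‖ ≤ M ∧
    |Torus.partialDeriv i (Torus.partialDeriv j (Torus.partialDeriv k (θ s'))) x| ≤ M) →
    ∀ ε : ℝ, 0 < ε → ∃ γ : ℝ, 0 < γ ∧ ∀ᶠ N : ℕ in atTop,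
    renyiDiv (1 + γ)
    ((Φ N).lawAt (localGibbsLaw σ (fun x => ρ s x * Real.exp (hsExcessFreeEnergy (ρ s x * σ ^ 3) +
    ρ s x * σ ^ 3 * deriv hsExcessFreeEnergy (ρ s x * σ ^ 3))) (u s) (θ s) N (Φ N)) (t - s))
    (localGibbsLaw σ (fun x => ρ t x * Real.exp (hsExcessFreeEnergy (ρ t x * σ ^ 3) +
    ρ t x * σ ^ 3 * deriv hsExcessFreeEnergy (ρ t x * σ ^ 3))) (u t) (θ t) N (Φ N)) ≤
    ENNReal.ofReal ε * ((N : ℝ≥0∞) + 1) := by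
  obtain ⟨ηD, hηD, σD, hσD, hD⟩ := hNAD
  obtain ⟨ηF, hηF, hF⟩ := hFlat hLGC
  obtain ⟨ηZ, hηZ, hZc⟩ := tendsto_isentropicCentring hLDA
  obtain ⟨ηE, hηE, -, hfc, hdc⟩ := exists_eos_band
  refine ⟨min (min ηD ηF) (min ηZ ηE), lt_min (lt_min hηD hηF) (lt_min hηZ hηE), min σD (1 / 2),
    lt_min hσD one_half_pos, fun σ hσ hσlt M hM => ?_⟩
  have hσD' : σ < σD := lt_of_lt_of_le hσlt (min_le_left _ _)
  have hσ2 : σ ≤ 1 / 2 := (lt_of_lt_of_le hσlt (min_le_right _ _)).le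
  obtain ⟨τ₁, hτ₁, hDτ⟩ := hD σ hσ hσD' M hM
  refine ⟨τ₁, hτ₁, fun T ρ θ u hsol hmass Φ s hs t ht hguard ε hε => ?_⟩
  have hst : s ≤ t := ht.1
  have htT : t ∈ Ico 0 T := ⟨hs.1.trans ht.1, lt_of_lt_of_le ht.2 (min_le_left _ _)⟩
  have hbandD : ∀ s' ∈ Icc s t, ∀ x, ρ s' x * σ ^ 3 < ηD := fun s' hs' x =>
    lt_of_lt_of_le (hguard s' hs' x).1 ((min_le_left _ _).trans (min_le_left _ _))
  have hbandF : ∀ s' ∈ Icc s t, ∀ x, ρ s' x * σ ^ 3 ≤ ηF := fun s' hs' x =>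
    (lt_of_lt_of_le (hguard s' hs' x).1 ((min_le_left _ _).trans (min_le_right _ _))).le
  have hbandZ : ∀ s' ∈ Icc s t, ∀ x, ρ s' x * σ ^ 3 < ηZ := fun s' hs' x =>
    lt_of_lt_of_le (hguard s' hs' x).1 ((min_le_right _ _).trans (min_le_left _ _))
  have hbandE : ∀ s' ∈ Icc s t, ∀ x, ρ s' x * σ ^ 3 < ηE := fun s' hs' x =>
    lt_of_lt_of_le (hguard s' hs' x).1 ((min_le_right _ _).trans (min_le_right _ _))
  have hsI : s ∈ Icc s t := ⟨le_rfl, hst⟩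
  have htI : t ∈ Icc s t := ⟨hst, le_rfl⟩
  have hρsc : Continuous (ρ s) := (hsol.smooth_density.isSmooth_slice hs).continuous
  have husc : Continuous (u s) := (hsol.smooth_velocity.isSmooth_slice hs).continuous
  have hθsc : Continuous (θ s) := (hsol.smooth_temperature.isSmooth_slice hs).continuous
  have hρs0 : ∀ x, 0 < ρ s x := hsol.density_pos s hs
  have hθs0 : ∀ x, 0 < θ s x := hsol.temperature_pos s hs
  have hρtc : Continuous (ρ t) := (hsol.smooth_density.isSmooth_slice htT).continuous
  have hutc : Continuous (u t) := (hsol.smooth_velocity.isSmooth_slice htT).continuous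
  have hθtc : Continuous (θ t) := (hsol.smooth_temperature.isSmooth_slice htT).continuous
  have hρt0 : ∀ x, 0 < ρ t x := hsol.density_pos t htT
  have hθt0 : ∀ x, 0 < θ t x := hsol.temperature_pos t htT
  set As : T3 → ℝ := fun x => ρ s x * Real.exp (hsExcessFreeEnergy (ρ s x * σ ^ 3) +
    ρ s x * σ ^ 3 * deriv hsExcessFreeEnergy (ρ s x * σ ^ 3)) with hAs_def
  set At : T3 → ℝ := fun x => ρ t x * Real.exp (hsExcessFreeEnergy (ρ t x * σ ^ 3) +
    ρ t x * σ ^ 3 * deriv hsExcessFreeEnergy (ρ t x * σ ^ 3)) with hAt_def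
  have hAsc : Continuous As := continuous_lda_of_band hfc hdc hσ hρsc hρs0 (hbandE s hsI)
  have hAtc : Continuous At := continuous_lda_of_band hfc hdc hσ hρtc hρt0 (hbandE t htI)
  have hAs0 : ∀ x, 0 < As x := fun x => mul_pos (hρs0 x) (Real.exp_pos _)
  have hAt0 : ∀ x, 0 < At x := fun x => mul_pos (hρt0 x) (Real.exp_pos _)
  set ψs : T3 × V3 → ℝ := localGibbsProfile As (u s) (θ s) with hψs_def
  set ψt : T3 × V3 → ℝ := localGibbsProfile At (u t) (θ t) with hψt_def
  have hψs0 : ∀ y, 0 < ψs y := localGibbsProfile_pos hAs0 hθs0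
  have hψt0 : ∀ y, 0 < ψt y := localGibbsProfile_pos hAt0 hθt0
  have hψsm : Measurable ψs := measurable_localGibbsProfile hAsc hθsc husc
  have hψtm : Measurable ψt := measurable_localGibbsProfile hAtc hθtc hutc
  have hZs : ∀ N : ℕ, 0 < canonicalPartition (Torus.geometry (Fin 3)) (hsDiameter σ N) (N + 1) ψs := by
    intro N
    rw [hψs_def, canonicalPartition_eq_posPartition hAsc hθsc husc (fun x => (hAs0 x).le) hθs0]
    exact posPartition_pos hAsc hAs0 hσ2 N
  have hZt : ∀ N : ℕ, 0 < canonicalPartition (Torus.geometry (Fin 3)) (hsDiameter σ N) (N + 1) ψt := by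
    intro N
    rw [hψt_def, canonicalPartition_eq_posPartition hAtc hθtc hutc (fun x => (hAt0 x).le) hθt0]
    exact posPartition_pos hAtc hAt0 hσ2 N
  set Gs : ∀ N : ℕ, Measure (Config (N + 1) (Fin 3) T3) := fun N => localGibbsLaw σ As (u s) (θ s) N (Φ N)
    with hGs_def
  set Gt : ∀ N : ℕ, Measure (Config (N + 1) (Fin 3) T3) := fun N => localGibbsLaw σ At (u t) (θ t) N (Φ N)
    with hGt_def
  have hGsP : ∀ N, IsProbabilityMeasure (Gs N) := fun N =>
    isProbabilityMeasure_localGibbsLaw hAsc hθsc husc hAs0 hθs0 hσ2 N (Φ N)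
  have hGtP : ∀ N, IsProbabilityMeasure (Gt N) := fun N =>
    isProbabilityMeasure_localGibbsLaw hAtc hθtc hutc hAt0 hθt0 hσ2 N (Φ N)
  have hGsac : ∀ N, Gs N ≪ liouville (Torus.geometry (Fin 3)) (N + 1) (hsDiameter σ N) := fun N => by
    rw [hGs_def]; dsimp only; unfold localGibbsLaw particleLaw; exact withDensity_absolutelyContinuous _ _
  set bs : ℝ := ∫ x, ρ s x * (Real.log (ρ s x * Real.exp (hsExcessFreeEnergy (ρ s x * σ ^ 3) +
      ρ s x * σ ^ 3 * deriv hsExcessFreeEnergy (ρ s x * σ ^ 3))) -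
    3 / 2 * Real.log (2 * Real.pi * θ s x) - 3 / 2) with hbs_def
  set bt : ℝ := ∫ x, ρ t x * (Real.log (ρ t x * Real.exp (hsExcessFreeEnergy (ρ t x * σ ^ 3) +
      ρ t x * σ ^ 3 * deriv hsExcessFreeEnergy (ρ t x * σ ^ 3))) -
    3 / 2 * Real.log (2 * Real.pi * θ t x) - 3 / 2) with hbt_def
  set c : ℕ → ℝ := fun N =>
    ((N : ℝ) + 1)⁻¹ * Real.log (canonicalPartition (Torus.geometry (Fin 3)) (hsDiameter σ N) (N + 1) ψt) -
      ((N : ℝ) + 1)⁻¹ * Real.log (canonicalPartition (Torus.geometry (Fin 3)) (hsDiameter σ N) (N + 1) ψs) -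
      bt + bs with hc_def
  set X : ∀ N : ℕ, Config (N + 1) (Fin 3) T3 → ℝ := fun N z =>
    (∑ i, Real.log (ψs (z i))) - ((N : ℝ) + 1) * bs with hX_def
  set Y : ∀ N : ℕ, Config (N + 1) (Fin 3) T3 → ℝ := fun N z =>
    ((N : ℝ) + 1) * bt - ∑ i, Real.log (ψt ((Φ N).flow (t - s) z i)) with hY_def
  have hXm : ∀ N, Measurable (X N) := fun N =>
    (Finset.measurable_sum _ fun i _ => (hψsm.comp (measurable_pi_apply i)).log).sub measurable_const
  have hYm : ∀ N, Measurable (Y N) := fun N =>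
    measurable_const.sub (Finset.measurable_sum _ fun i _ =>
      (hψtm.comp ((measurable_pi_apply i).comp ((Φ N).measurable_flow (t - s)))).log)
  have hn : Tendsto (fun N : ℕ => (N : ℝ) + 1) atTop atTop :=
    tendsto_atTop_add_const_right _ 1 tendsto_natCast_atTop_atTop
  have hXmom : ∀ ε' : ℝ, 0 < ε' → ∃ γ₁ : ℝ, 0 < γ₁ ∧ ∀ γ : ℝ, 0 < γ → γ ≤ γ₁ → ∀ᶠ N in atTop,
      ∫⁻ z, ENNReal.ofReal (Real.exp (γ * X N z)) ∂Gs N ≤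
        ENNReal.ofReal (Real.exp (γ * ε' * ((N : ℝ) + 1))) :=
    hF σ hσ hσ2 (ρ s) (θ s) (u s) hρsc hθsc husc hρs0 hθs0 (hmass s hs) (hbandF s hsI) Φ
  have hYmom : ∃ K : ℝ, ∃ γ₂ : ℝ, 0 < γ₂ ∧ ∀ γ : ℝ, 0 < γ → γ ≤ γ₂ → ∀ᶠ N in atTop,
      ∫⁻ z, ENNReal.ofReal (Real.exp (γ * Y N z)) ∂Gs N ≤
        ENNReal.ofReal (Real.exp (γ * K * ((N : ℝ) + 1))) := by
    obtain ⟨K₀, γ₂, hγ₂, hK⟩ := hKE σ hσ hσ2 As (θ s) (u s) hAsc hθsc husc hAs0 hθs0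
    set M' : ℝ := max M 1 with hM'
    have hM'1 : 1 ≤ M' := le_max_right _ _
    have hMM' : M ≤ M' := le_max_left _ _
    have hM'0 : 0 < M' := lt_of_lt_of_le one_pos hM'1
    obtain ⟨C, hC⟩ := exists_neg_log_localGibbsProfile_le (a := At) (θ := θ t) (u := u t) hAtc hAt0 hM'1
      (fun x => (hguard t htI x).2.2.1.trans hMM')
      (fun x => le_trans (inv_anti₀ hM hMM') (hguard t htI x).2.2.2.1)
      (fun x => (hguard t htI x).2.2.2.2.1.trans hMM')
    refine ⟨bt + C + 2 * M' * K₀, γ₂ / (2 * M'), by positivity, fun γ hγ hγle => ?_⟩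
    refine Eventually.of_forall fun N => ?_
    haveI := hGsP N
    have hγ' : 2 * M' * γ ≤ γ₂ := by
      rw [le_div_iff₀ (by positivity)] at hγle; linarith
    have hKN := hK (2 * M' * γ) (by positivity) hγ' N (Φ N)
    have hae : ∀ᵐ z ∂Gs N, Y N z ≤ ((N : ℝ) + 1) * (bt + C) + 2 * M' * configEnergy z := by
      filter_upwards [hardSphereFlow_ae_mem_good_of_absolutelyContinuous (Φ N) (hGsac N)] with z hz
      have hEn : configEnergy ((Φ N).flow (t - s) z) = configEnergy z :=
        HardSphereFlow.configEnergy_flow (Φ N) hz (t - s)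
      have hsum : -∑ i, Real.log (ψt ((Φ N).flow (t - s) z i)) ≤
          ((N : ℝ) + 1) * C + 2 * M' * configEnergy ((Φ N).flow (t - s) z) := by
        have hterm : ∀ i, -Real.log (ψt ((Φ N).flow (t - s) z i)) ≤
            C + M' * ‖((Φ N).flow (t - s) z i).2‖ ^ 2 := fun i => hC _ _
        calc -∑ i, Real.log (ψt ((Φ N).flow (t - s) z i))
            = ∑ i, -Real.log (ψt ((Φ N).flow (t - s) z i)) := by rw [Finset.sum_neg_distrib]
          _ ≤ ∑ i, (C + M' * ‖((Φ N).flow (t - s) z i).2‖ ^ 2) := Finset.sum_le_sum fun i _ => hterm i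
          _ = ((N : ℝ) + 1) * C + 2 * M' * configEnergy ((Φ N).flow (t - s) z) := by
              rw [Finset.sum_add_distrib, Finset.sum_const, Finset.card_univ, Fintype.card_fin,
                nsmul_eq_mul, configEnergy, Finset.mul_sum, Finset.mul_sum]
              push_cast
              congr 1
              exact Finset.sum_congr rfl fun i _ => by ring
      rw [hEn] at hsum
      rw [hY_def]
      dsimp only
      linarith
    have hmeas : Measurable fun z : Config (N + 1) (Fin 3) T3 =>
        ENNReal.ofReal (Real.exp ((2 * M' * γ) * configEnergy z)) :=
      (measurable_const.mul measurable_configEnergy_T3).exp.ennreal_ofReal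
    calc ∫⁻ z, ENNReal.ofReal (Real.exp (γ * Y N z)) ∂Gs N
        ≤ ∫⁻ z, ENNReal.ofReal (Real.exp (γ * ((N : ℝ) + 1) * (bt + C))) *
            ENNReal.ofReal (Real.exp ((2 * M' * γ) * configEnergy z)) ∂Gs N := by
          refine lintegral_mono_ae ?_
          filter_upwards [hae] with z hz
          rw [← ENNReal.ofReal_mul (Real.exp_pos _).le, ← Real.exp_add]
          refine ENNReal.ofReal_le_ofReal (Real.exp_le_exp.2 ?_)
          have := mul_le_mul_of_nonneg_left hz hγ.le
          nlinarith
      _ = ENNReal.ofReal (Real.exp (γ * ((N : ℝ) + 1) * (bt + C))) *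
            ∫⁻ z, ENNReal.ofReal (Real.exp ((2 * M' * γ) * configEnergy z)) ∂Gs N :=
          lintegral_const_mul _ hmeas
      _ ≤ ENNReal.ofReal (Real.exp (γ * ((N : ℝ) + 1) * (bt + C))) *
            ENNReal.ofReal (Real.exp ((2 * M' * γ) * K₀ * ((N : ℝ) + 1))) := by
          gcongr
      _ = ENNReal.ofReal (Real.exp (γ * (bt + C + 2 * M' * K₀) * ((N : ℝ) + 1))) := by
          rw [← ENNReal.ofReal_mul (Real.exp_pos _).le, ← Real.exp_add]
          congr 2
          ring
  have hYld : ∀ δ : ℝ, 0 < δ → ∃ C : ℝ, 0 < C ∧ ∀ᶠ N in atTop,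
      Gs N {z | δ * ((N : ℝ) + 1) < Y N z} ≤ ENNReal.ofReal (C * Real.exp (-(C⁻¹ * ((N : ℝ) + 1)))) := by
    intro δ hδ
    obtain ⟨C, hC, hCN⟩ := hDτ T ρ θ u hsol hmass Φ s hs t ht
      (fun s' hs' x => ⟨hbandD s' hs' x, (hguard s' hs' x).2⟩) δ hδ
    refine ⟨C, hC, Eventually.of_forall fun N => ?_⟩
    have hset : {z : Config (N + 1) (Fin 3) T3 | δ * ((N : ℝ) + 1) < Y N z} =
        {z | ((N : ℝ) + 1)⁻¹ * ∑ i, Real.log (ψt ((Φ N).flow (t - s) z i)) < bt - δ} := by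
      ext z
      simp only [mem_setOf_eq, hY_def]
      have hN : (0 : ℝ) < (N : ℝ) + 1 := by positivity
      rw [inv_mul_lt_iff₀ hN]
      constructor <;> intro h <;> nlinarith
    rw [hset]
    have h := hCN N
    simp only [hψt_def, hAt_def, hbt_def] at h ⊢
    convert h using 2
  haveI := hGsP
  obtain ⟨γ, hγ, hev⟩ := lintegral_exp_mul_add_le_of_largeDeviation Gs X Y hXm hYm (fun N => (N : ℝ) + 1)
    hn hXmom hYmom hYld (ε / 2) (half_pos hε)
  have hcN : ∀ᶠ N in atTop, c N ≤ ε / 2 :=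
    (hZc σ hσ T ρ θ u hsol hmass Φ s hs t ⟨hst, htT.2⟩ hbandZ).eventually_le_const (half_pos hε)
  refine ⟨γ, hγ, ?_⟩
  filter_upwards [hev, hcN] with N hevN hcNle
  haveI : IsProbabilityMeasure (Gs N) := hGsP N
  haveI : IsProbabilityMeasure (Gt N) := hGtP N
  have hq : (1 : ℝ) < 1 + γ := by linarith
  have hH := hellingerIntegral_lawAt_localGibbsLaw_eq_lintegral (σ := σ) (a := As) (θ' := θ s)
    (a' := At) (θ'' := θ t) (u' := u s) (u'' := u t) N (Φ N) hAsc hθsc husc hAtc hθtc hutc hAt0 hθt0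
    (hZt N) hq (t - s)
  set L := liouville (Torus.geometry (Fin 3)) (N + 1) (hsDiameter σ N) with hL_def
  have hgood : ∀ᵐ z ∂L, z ∈ (Φ N).good := (Φ N).ae_mem_good
  have hkey : ∀ z ∈ (Φ N).good,
      Real.log (canonicalDensity (Torus.geometry (Fin 3)) (hsDiameter σ N) (N + 1) ψs z) -
        Real.log (canonicalDensity (Torus.geometry (Fin 3)) (hsDiameter σ N) (N + 1) ψt
          ((Φ N).flow (t - s) z)) = ((N : ℝ) + 1) * c N + (X N z + Y N z) := by
    intro z hz
    have hzD := (Φ N).good_subset hz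
    have hwD := (Φ N).good_subset ((Φ N).mapsTo_good (t - s) hz)
    rw [log_canonicalDensity_eq hψs0 (hZs N) hzD, log_canonicalDensity_eq hψt0 (hZt N) hwD,
      hc_def, hX_def, hY_def]
    dsimp only
    have hN : ((N : ℝ) + 1) ≠ 0 := by positivity
    field_simp
    ring
  have hcongr : ∀ᵐ z ∂L,
      ENNReal.ofReal (canonicalDensity (Torus.geometry (Fin 3)) (hsDiameter σ N) (N + 1) ψt
          ((Φ N).flow (t - s) z)) *
        (ENNReal.ofReal (canonicalDensity (Torus.geometry (Fin 3)) (hsDiameter σ N) (N + 1) ψs z) *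
          (ENNReal.ofReal (canonicalDensity (Torus.geometry (Fin 3)) (hsDiameter σ N) (N + 1) ψt
            ((Φ N).flow (t - s) z)))⁻¹) ^ (1 + γ) =
      ENNReal.ofReal (canonicalDensity (Torus.geometry (Fin 3)) (hsDiameter σ N) (N + 1) ψs z) *
        ENNReal.ofReal (Real.exp (γ * (((N : ℝ) + 1) * c N) + γ * (X N z + Y N z))) := by
    filter_upwards [hgood] with z hz
    have hzD := (Φ N).good_subset hz
    have hwD := (Φ N).good_subset ((Φ N).mapsTo_good (t - s) hz)
    rw [ofReal_mul_rpow_div_eq γ (canonicalDensity_pos_of_mem hψs0 (hZs N) hzD)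
      (canonicalDensity_pos_of_mem hψt0 (hZt N) hwD), hkey z hz, mul_add]
  have hfm : Measurable fun z : Config (N + 1) (Fin 3) T3 =>
      ENNReal.ofReal (canonicalDensity (Torus.geometry (Fin 3)) (hsDiameter σ N) (N + 1) ψs z) :=
    (measurable_canonicalDensity _ _ hψsm).ennreal_ofReal
  have hexpm : Measurable fun z : Config (N + 1) (Fin 3) T3 =>
      ENNReal.ofReal (Real.exp (γ * (((N : ℝ) + 1) * c N) + γ * (X N z + Y N z))) :=
    (measurable_const.add (measurable_const.mul ((hXm N).add (hYm N)))).exp.ennreal_ofReal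
  have hGs_eq : Gs N = L.withDensity fun z =>
      ENNReal.ofReal (canonicalDensity (Torus.geometry (Fin 3)) (hsDiameter σ N) (N + 1) ψs z) := rfl
  have hexpm' : Measurable fun z : Config (N + 1) (Fin 3) T3 =>
      ENNReal.ofReal (Real.exp (γ * (X N z + Y N z))) :=
    (measurable_const.mul ((hXm N).add (hYm N))).exp.ennreal_ofReal
  have hHval : hellingerIntegral (1 + γ) ((Φ N).lawAt (Gs N) (t - s)) (Gt N) =
      ENNReal.ofReal (Real.exp (γ * (((N : ℝ) + 1) * c N))) *
        ∫⁻ z, ENNReal.ofReal (Real.exp (γ * (X N z + Y N z))) ∂Gs N := by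
    calc hellingerIntegral (1 + γ) ((Φ N).lawAt (Gs N) (t - s)) (Gt N)
        = ∫⁻ z, ENNReal.ofReal (canonicalDensity (Torus.geometry (Fin 3)) (hsDiameter σ N) (N + 1) ψt
              ((Φ N).flow (t - s) z)) *
            (ENNReal.ofReal (canonicalDensity (Torus.geometry (Fin 3)) (hsDiameter σ N) (N + 1) ψs z) *
              (ENNReal.ofReal (canonicalDensity (Torus.geometry (Fin 3)) (hsDiameter σ N) (N + 1) ψt
                ((Φ N).flow (t - s) z)))⁻¹) ^ (1 + γ) ∂L := hH
      _ = ∫⁻ z, ENNReal.ofReal (canonicalDensity (Torus.geometry (Fin 3)) (hsDiameter σ N) (N + 1) ψs z) *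
            ENNReal.ofReal (Real.exp (γ * (((N : ℝ) + 1) * c N) + γ * (X N z + Y N z))) ∂L :=
          lintegral_congr_ae hcongr
      _ = ∫⁻ z, ENNReal.ofReal (Real.exp (γ * (((N : ℝ) + 1) * c N) + γ * (X N z + Y N z))) ∂Gs N := by
          rw [hGs_eq, lintegral_withDensity_eq_lintegral_mul _ hfm hexpm]
          rfl
      _ = ∫⁻ z, ENNReal.ofReal (Real.exp (γ * (((N : ℝ) + 1) * c N))) *
            ENNReal.ofReal (Real.exp (γ * (X N z + Y N z))) ∂Gs N := by
          refine lintegral_congr fun z => ?_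
          rw [← ENNReal.ofReal_mul (Real.exp_pos _).le, ← Real.exp_add]
      _ = ENNReal.ofReal (Real.exp (γ * (((N : ℝ) + 1) * c N))) *
            ∫⁻ z, ENNReal.ofReal (Real.exp (γ * (X N z + Y N z))) ∂Gs N :=
          lintegral_const_mul _ hexpm'
  have hHle : hellingerIntegral (1 + γ) ((Φ N).lawAt (Gs N) (t - s)) (Gt N) ≤
      ENNReal.ofReal (Real.exp (γ * (ε * ((N : ℝ) + 1)))) := by
    rw [hHval]
    calc ENNReal.ofReal (Real.exp (γ * (((N : ℝ) + 1) * c N))) *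
          ∫⁻ z, ENNReal.ofReal (Real.exp (γ * (X N z + Y N z))) ∂Gs N
        ≤ ENNReal.ofReal (Real.exp (γ * (((N : ℝ) + 1) * (ε / 2)))) *
            ENNReal.ofReal (Real.exp (γ * (ε / 2) * ((N : ℝ) + 1))) := by
          gcongr
      _ = ENNReal.ofReal (Real.exp (γ * (ε * ((N : ℝ) + 1)))) := by
          rw [← ENNReal.ofReal_mul (Real.exp_pos _).le, ← Real.exp_add]
          congr 2
          ring
  have hfinal := renyiDiv_le_of_hellingerIntegral_le (μ := (Φ N).lawAt (Gs N) (t - s)) (ν := Gt N) hγ hHle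
  rw [hGs_def, hGt_def] at hfinal
  dsimp only at hfinal
  refine hfinal.trans (le_of_eq ?_)
  rw [ENNReal.ofReal_mul hε.le]
  congr 1
  rw [ENNReal.ofReal_add (by positivity) zero_le_one, ENNReal.ofReal_natCast, ENNReal.ofReal_one]

end Reduction

end Summit.AtomisticToContinuum.HydrodynamicLimit.Theorems.RestartPrinciple.IsentropicRegibbsification

end
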